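import Summits.AnomalousDissipation.AnomalousDissipation.Theorems.DenseLoudDesignerForces.Negative.WitnessAnatomy

/-!
# Negative knowledge for the crux `DenseLoudDesignerForces` (stmt-AnomalousDissipation-1143), XI: generalised
# Beltrami witnesses are uniformly quiet; the palinstrophy / viscous-force floor of loud orbits

Certified copy of §13–§14 of the cdisprove work file (generation 3).
* §13 REFUTED STRENGTHENING: if the convective term of a witness is an exact gradient at all times,
  `(u·∇)u = ∇q(t)` (Beltrami/Trkalian fields `curl u ∥ u`, parallel and unidirectional shear flows, every flow with
  irrotational Lamb vector `ω × u`), then `(u, p + q)` solves the linear Stokes system with the same force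
  (`isClassicalStokesSolutionOn_of_convect_eq_gradient`), so the Stokes kill of `FalseWithoutConvection` applies:
  `ε² ≤ E(E + Λ₂(c)²)/(2(j+1))` on the generalised-Beltrami loud sets (`beltrami_shell`), no window
  (`not_window_beltrami`, and the window-level Stokes statement for ANY stock `not_window_stokes`), and
  `denseLoudDesignerForces_false_beltrami`.  Reading: the solenoidal Lamb vector of a loud orbit must do O(1) work
  on the force; depletion of nonlinearity is incompatible with loudness.
* §14 WITNESS ANATOMY II: `(τ⁻¹∫₀^τ‖∇u‖₂²)² ≤ ⟨‖u‖²⟩ · τ⁻¹∫₀^τ‖Δu‖₂²` (`mean_gradNormSq_sq_le`, slice interpolation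
  `‖∇u‖² = -∫⟪u,Δu⟫ ≤ ‖u‖‖Δu‖` and Cauchy–Schwarz in time) with the enstrophy floor of `WitnessAnatomy` give the
  PALINSTROPHY FLOOR `τ⁻¹∫₀^τ‖Δu‖₂² ≥ ε²/(ν²E)` (`mean_laplacianNormSq_ge`) and the VISCOUS-FORCE FLOOR
  `τ⁻¹∫₀^τ∫‖νΔu‖² ≥ ε²/E` (`mean_viscousForce_sq_ge`, `exists_palinstrophy_ge_of_mem_loudSet`): the viscous force
  of a loud orbit is of order one in mean-square `L²` at every level, carried by ever finer scales.
Supports stmt-AnomalousDissipation-1143.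
-/

noncomputable section

namespace Summit.AnomalousDissipation.AnomalousDissipation.Theorems.DenseLoudDesignerForces.Negative

open scoped BigOperators Topology ENNReal InnerProductSpace
open Filter Set MeasureTheory UnitAddTorus
open Literature.Analysis.FunctionSpaces Literature.Analysis.FluidPDE
open Summit.AnomalousDissipation.AnomalousDissipation.Theses.BaireTransfer

/-! ## §13 Refuted strengthening: gradient-nonlinearity (generalised Beltrami) witnesses are uniformly quiet

If the convective term of a witness is an exact gradient at all times, `(u·∇)u = ∇q(t)` with `q` jointly smooth
— generalised Beltrami states: Beltrami/Trkalian fields `curl u ∥ u` (`(u·∇)u = ∇|u|²/2`), parallel and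
unidirectional shear flows (`(u·∇)u = 0`), circular/potential-vortex states, every flow whose Lamb vector
`ω × u` is irrotational — then `(u, p + q)` solves the LINEAR Stokes system with the same force, so §7 applies
verbatim: `ε² ≤ E(E + Λ₂(c)²)/(2(j+1))` on the generalised-Beltrami loud sets, which are therefore EMPTY inside
every bounded set at large levels, for every stock and every coefficient vector.  READING: the solenoidal part of
the Lamb vector `P(ω × u)` of a loud orbit must do O(1) work against the force (the Reynolds-work floor of §8 is a
floor on `τ⁻¹∫₀^τ∫⟪ω × u, f_c⟫`); Beltramisation (depletion of nonlinearity) is incompatible with loudness. -/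

section Beltrami

variable {S : Finset (Fin 3 → ℤ)} {E ε : ℝ}

/-- Additivity of the torus gradient on smooth slices. -/
theorem gradient_add_apply {a b : (UnitAddTorus (Fin 3)) → ℝ} (ha : Torus.IsSmooth a) (hb : Torus.IsSmooth b) (x : (UnitAddTorus (Fin 3))) :
    Torus.gradient (fun y => a y + b y) x = Torus.gradient a x + Torus.gradient b x := by
  have hda : DifferentiableAt ℝ (Torus.liftAt a x) 0 := ((ha.liftAt x).differentiable (by simp)) 0
  have hdb : DifferentiableAt ℝ (Torus.liftAt b x) 0 := ((hb.liftAt x).differentiable (by simp)) 0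
  have hl : Torus.liftAt (fun y => a y + b y) x = fun v => Torus.liftAt a x v + Torus.liftAt b x v := rfl
  simp only [Torus.gradient, _root_.gradient, hl]
  rw [fderiv_fun_add hda hdb, map_add]

/-- GRADIENT NONLINEARITY REDUCES TO STOKES: a classical NS solution with `(u·∇)u = ∇q`, `q` jointly smooth, is a
classical solution of the linear Stokes system with pressure `p + q` and the same force. -/
theorem isClassicalStokesSolutionOn_of_convect_eq_gradient {ν : ℝ} {F : (UnitAddTorus (Fin 3)) → (EuclideanSpace ℝ (Fin 3))} {u : ℝ → (UnitAddTorus (Fin 3)) → (EuclideanSpace ℝ (Fin 3))}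
    {p q : ℝ → (UnitAddTorus (Fin 3)) → ℝ} (h : Torus.IsClassicalNSSolutionOn univ ν (fun _ => F) u p)
    (hq : Torus.IsSmoothSpaceTimeOn univ q) (hconv : ∀ t x, Torus.convect (u t) (u t) x = Torus.gradient (q t) x) :
    IsClassicalStokesSolutionOn univ ν (fun _ => F) u (fun t x => p t x + q t x) where
  smooth_velocity := h.smooth_velocity
  smooth_pressure := h.smooth_pressure.add hq
  momentum := by
    intro t _ x
    have hm := h.momentum t (mem_univ t) x
    have hpt : Torus.IsSmooth (p t) := h.smooth_pressure.isSmooth_slice (mem_univ t)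
    have hqt : Torus.IsSmooth (q t) := hq.isSmooth_slice (mem_univ t)
    show Torus.timeDerivWithin univ u t x =
      ν • Torus.laplacian (u t) x - Torus.gradient (fun y => p t y + q t y) x + F x
    rw [gradient_add_apply hpt hqt, ← hconv t x]
    calc Torus.timeDerivWithin univ u t x
        = (Torus.timeDerivWithin univ u t x + Torus.convect (u t) (u t) x) - Torus.convect (u t) (u t) x := by abel
      _ = (ν • Torus.laplacian (u t) x - Torus.gradient (p t) x + F x) - Torus.convect (u t) (u t) x := by rw [hm]
      _ = _ := by abel
  divFree := h.divFree

/-- The GENERALISED-BELTRAMI LOUD SET: the crux's `LOUD_j(S,E,ε)` with witnesses whose convective term is an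
exact gradient (`(u·∇)u = ∇q`, `q` jointly smooth) at all times. -/
def beltramiLoudSet (S : Finset (Fin 3 → ℤ)) (E ε : ℝ) (j : ℕ) : Set (↥S → (EuclideanSpace ℂ (Fin 3))) :=
  {c : ↥S → (EuclideanSpace ℂ (Fin 3)) | ∃ ν : ℝ, 0 < ν ∧ ν < 1 / ((j : ℝ) + 1) ∧
    ∃ (τ : ℝ) (u : ℝ → (UnitAddTorus (Fin 3)) → (EuclideanSpace ℝ (Fin 3))) (p : ℝ → (UnitAddTorus (Fin 3)) → ℝ), 0 < τ ∧
      Torus.IsClassicalNSSolutionOn Set.univ ν (fun _ => force S c) u p ∧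
      Function.Periodic u τ ∧ meanEnergy u ≤ E ∧ ε ≤ meanDissipation ν u ∧
      ∃ q : ℝ → (UnitAddTorus (Fin 3)) → ℝ, Torus.IsSmoothSpaceTimeOn Set.univ q ∧
        ∀ t x, Torus.convect (u t) (u t) x = Torus.gradient (q t) x}

/-- Generalised-Beltrami loud points are loud points. -/
theorem beltramiLoudSet_subset_loudSet (S : Finset (Fin 3 → ℤ)) (E ε : ℝ) (j : ℕ) :
    beltramiLoudSet S E ε j ⊆ loudSet S E ε j := by
  rintro c ⟨ν, hν, hνj, τ, u, p, hτ, hsol, hper, hEu, hεu, -⟩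
  exact ⟨ν, hν, hνj, τ, u, p, hτ, hsol, hper, hEu, hεu⟩

/-- Generalised-Beltrami loud points are STOKES-loud points (same witness, pressure `p + q`). -/
theorem beltramiLoudSet_subset_stokesLoudSet (S : Finset (Fin 3 → ℤ)) (E ε : ℝ) (j : ℕ) :
    beltramiLoudSet S E ε j ⊆ stokesLoudSet S E ε j := by
  rintro c ⟨ν, hν, hνj, τ, u, p, hτ, hsol, hper, hEu, hεu, q, hq, hconv⟩
  exact ⟨ν, hν, hνj, τ, u, _, hτ, isClassicalStokesSolutionOn_of_convect_eq_gradient hsol hq hconv, hper, hEu, hεu⟩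

/-- GENERALISED-BELTRAMI LEVEL SHELL: `c ∈ bLOUD_j(S,E,ε)`, `0 ≤ ε` ⇒ `ε² ≤ E(E + Λ₂(c)²)/(2(j+1))`. -/
theorem beltrami_shell (hε : 0 ≤ ε) {j : ℕ} {c : ↥S → (EuclideanSpace ℂ (Fin 3))} (hc : c ∈ beltramiLoudSet S E ε j) :
    0 ≤ E ∧ ε ^ 2 ≤ E * (E + lapBound S c ^ 2) / (2 * ((j : ℝ) + 1)) :=
  stokes_shell hε (beltramiLoudSet_subset_stokesLoudSet S E ε j hc)

/-- STOKES WITNESSES CARRY NO WINDOW (window-level form of §7, any stock): no non-empty `U ⊆ P_S` lies in the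
closure of `sLOUD_j(S,E,ε)` for all `j` (`ε > 0`). -/
theorem not_window_stokes (S : Finset (Fin 3 → ℤ)) (hε : 0 < ε) {U : Set (↥S → (EuclideanSpace ℂ (Fin 3)))} (hne : U.Nonempty)
    (hW : ∀ j : ℕ, U ⊆ closure (stokesLoudSet S E ε j)) : False := by
  obtain ⟨c, hc⟩ := hne
  set L2 : ℝ := ∑ i : Fin 3, ∑ k : ↥S, (2 * Real.pi * |(((k : Fin 3 → ℤ) i : ℤ) : ℝ)|) ^ 2 with hL2
  have hL2n : 0 ≤ L2 := Finset.sum_nonneg fun _ _ => Finset.sum_nonneg fun _ _ => by positivity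
  set C : ℝ := L2 * (‖c‖ + 1) with hC
  have hnear : ∀ j : ℕ, ∃ c' ∈ stokesLoudSet S E ε j, dist c' c < 1 := by
    intro j
    obtain ⟨c', hc', hd⟩ := Metric.mem_closure_iff.1 (hW j hc) 1 one_pos
    exact ⟨c', hc', by rwa [dist_comm]⟩
  have hlevel : ∀ j : ℕ, 0 ≤ E ∧ ε ^ 2 ≤ E * (E + C ^ 2) / (2 * ((j : ℝ) + 1)) := by
    intro j
    obtain ⟨c', hc', hd⟩ := hnear j
    obtain ⟨hE, hsh⟩ := stokes_shell hε.le hc'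
    refine ⟨hE, hsh.trans ?_⟩
    have hn : ‖c'‖ ≤ ‖c‖ + 1 := by
      calc ‖c'‖ ≤ ‖c‖ + ‖c' - c‖ := norm_le_norm_add_norm_sub' c' c
        _ ≤ ‖c‖ + 1 := by rw [← dist_eq_norm]; linarith
    have hlap : lapBound S c' ≤ C := (lapBound_le S c').trans (mul_le_mul_of_nonneg_left hn hL2n)
    have hj : (0 : ℝ) < 2 * ((j : ℝ) + 1) := by positivity
    gcongr
    exact lapBound_nonneg S c'
  have hE := (hlevel 0).1
  have hsq : ε ^ 2 ≤ 0 := by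
    refine le_of_forall_pos_le_add fun δ hδ => ?_
    obtain ⟨j, hj⟩ := exists_nat_gt (E * (E + C ^ 2) / (2 * δ))
    have h1 := (hlevel j).2
    have hj1 : (0 : ℝ) < 2 * ((j : ℝ) + 1) := by positivity
    have hK : E * (E + C ^ 2) / (2 * ((j : ℝ) + 1)) ≤ δ := by
      rw [div_le_iff₀ hj1]
      have h2 : E * (E + C ^ 2) / (2 * δ) < (j : ℝ) + 1 := hj.trans (lt_add_one _)
      rw [div_lt_iff₀ (by positivity)] at h2
      linarith
    linarith
  nlinarith

/-- REFUTED STRENGTHENING (generalised Beltrami): for every stock, all budgets (`ε > 0`) and every non-empty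
`U ⊆ P_S`, `U ⊄ closure bLOUD_j(S,E,ε)` for some level `j` — witnesses with gradient nonlinearity are uniformly
quiet. -/
theorem not_window_beltrami (S : Finset (Fin 3 → ℤ)) (hε : 0 < ε) {U : Set (↥S → (EuclideanSpace ℂ (Fin 3)))} (hne : U.Nonempty)
    (hW : ∀ j : ℕ, U ⊆ closure (beltramiLoudSet S E ε j)) : False :=
  not_window_stokes S hε hne fun j => (hW j).trans (closure_mono (beltramiLoudSet_subset_stokesLoudSet S E ε j))

/-- `DenseLoudDesignerForces` WITH GENERALISED-BELTRAMI WITNESSES: the crux verbatim, witnesses restricted to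
classical periodic NS solutions whose convective term is an exact gradient. -/
def DenseLoudDesignerForcesBeltrami : Prop :=
  ∀ S₀ : Finset (Fin 3 → ℤ), ∃ S : Finset (Fin 3 → ℤ), S₀ ⊆ S ∧ ∃ (E ε : ℝ), 0 < ε ∧
    ∃ U : Set (↥S → (EuclideanSpace ℂ (Fin 3))), IsOpen U ∧ U.Nonempty ∧ ∀ j : ℕ, U ⊆ closure (beltramiLoudSet S E ε j)

/-- THE CRUX IS FALSE FOR GENERALISED-BELTRAMI WITNESSES (any proof must produce a rotational Lamb vector doing
O(1) work on the force). -/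
theorem denseLoudDesignerForces_false_beltrami : ¬ DenseLoudDesignerForcesBeltrami := by
  intro h
  obtain ⟨S, -, E, ε, hε, U, -, hne, hW⟩ := h ∅
  exact not_window_beltrami S hε hne hW

end Beltrami

/-! ## §14 Witness anatomy II: the palinstrophy floor — the viscous force of a loud orbit is O(1) in `L²`

Interpolating `‖∇u‖₂² = -∫⟪u, Δu⟫ ≤ ‖u‖₂‖Δu‖₂` slice-wise and Cauchy–Schwarz in time give
`(τ⁻¹∫₀^τ‖∇u‖₂²)² ≤ ⟨‖u‖²⟩ · τ⁻¹∫₀^τ‖Δu‖₂²` for every periodic smooth field; with the enstrophy floor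
`τ⁻¹∫₀^τ‖∇u‖₂² ≥ ε/ν` of §8 a loud witness has PALINSTROPHY `τ⁻¹∫₀^τ‖Δu‖₂² ≥ ε²/(ν²E)`, i.e. the viscous force
`νΔu` has mean-square `L²` norm `≥ ε²/E`, uniformly as `ν → 0` (K41 predicts `ε^{3/2}ν^{-1/2} → ∞`).  READING:
loud orbits stay O(1)-far in `L²` from smooth force-free Euler balance; since `f_c` is band-limited and O(E|k|) on
windows (§6) while `νΔu` is carried by wavenumbers `→ ∞` (§9), the solenoidal acceleration
`P(∂ₜu + (u·∇)u) = νΔu + f_c` of a loud orbit is of order one in mean-square `L²` at arbitrarily fine scales. -/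

section Palinstrophy

variable {S : Finset (Fin 3 → ℤ)} {E ε ν τ : ℝ} {c : ↥S → (EuclideanSpace ℂ (Fin 3))} {u : ℝ → (UnitAddTorus (Fin 3)) → (EuclideanSpace ℝ (Fin 3))} {p : ℝ → (UnitAddTorus (Fin 3)) → ℝ}

/-- Slice interpolation in weighted form: `2‖∇v‖₂² ≤ λ∫‖v‖² + λ⁻¹∫‖Δv‖²` for smooth `v` and `λ > 0`. -/
theorem two_mul_gradNormSq_le_weighted {v : (UnitAddTorus (Fin 3)) → (EuclideanSpace ℝ (Fin 3))} (hv : Torus.IsSmooth v) {lam : ℝ} (hl : 0 < lam) :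
    2 * Torus.gradNormSq v ≤ lam * (∫ x, ‖v x‖ ^ 2) + (∫ x, ‖Torus.laplacian v x‖ ^ 2) / lam := by
  have hid := integral_inner_laplacian_self hv
  have hint : Integrable (fun x => (lam * ‖v x‖ ^ 2 + ‖Torus.laplacian v x‖ ^ 2 / lam) / 2) :=
    ((hv.norm_sq.integrable.const_mul lam).add (hv.laplacian.norm_sq.integrable.div_const lam)).div_const 2
  have hb := norm_integral_le_of_norm_le hint (ae_of_all _ fun x =>
    show ‖⟪v x, Torus.laplacian v x⟫_ℝ‖ ≤ (lam * ‖v x‖ ^ 2 + ‖Torus.laplacian v x‖ ^ 2 / lam) / 2 from by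
      rw [Real.norm_eq_abs]
      calc |⟪v x, Torus.laplacian v x⟫_ℝ| ≤ ‖v x‖ * ‖Torus.laplacian v x‖ := abs_real_inner_le_norm _ _
        _ ≤ (lam * ‖v x‖ ^ 2 + ‖Torus.laplacian v x‖ ^ 2 / lam) / 2 := by
            have := two_mul_le_weighted (a := ‖v x‖) (b := ‖Torus.laplacian v x‖) hl
            linarith)
  rw [Real.norm_eq_abs, hid, abs_neg, integral_div,
    integral_add (hv.norm_sq.integrable.const_mul lam) (hv.laplacian.norm_sq.integrable.div_const lam),
    integral_const_mul, integral_div] at hb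
  have hG : 0 ≤ Torus.gradNormSq v := Torus.gradNormSq_nonneg v
  rw [abs_of_nonneg hG] at hb
  linarith

/-- TIME-AVERAGED INTERPOLATION: `(τ⁻¹∫₀^τ‖∇u‖₂²)² ≤ ⟨‖u‖²⟩ · τ⁻¹∫₀^τ‖Δu‖₂²` for a jointly smooth `τ`-periodic
field. -/
theorem mean_gradNormSq_sq_le (hu : Torus.IsSmoothSpaceTimeOn univ u) (hper : Function.Periodic u τ) (hτ : 0 < τ) :
    (τ⁻¹ * ∫ t in (0 : ℝ)..τ, Torus.gradNormSq (u t)) ^ 2 ≤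
      meanEnergy u * (τ⁻¹ * ∫ t in (0 : ℝ)..τ, ∫ x, ‖Torus.laplacian (u t) x‖ ^ 2) := by
  have he_st : Torus.IsSmoothSpaceTimeOn univ (fun t x => ‖u t x‖ ^ 2) := by
    change ContDiffOn ℝ _ (fun z => ‖Torus.stLift u z‖ ^ 2) _
    exact hu.norm_sq ℝ
  have he_cont : Continuous fun t => ∫ x, ‖u t x‖ ^ 2 :=
    continuousOn_univ.1 (he_st.continuousOn_integral convex_univ)
  have hL_st : Torus.IsSmoothSpaceTimeOn univ (fun t x => ‖Torus.laplacian (u t) x‖ ^ 2) := by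
    have hl := hu.laplacian uniqueDiffOn_univ
    change ContDiffOn ℝ _ (fun z => ‖Torus.stLift (fun t x => Torus.laplacian (u t) x) z‖ ^ 2) _
    exact hl.norm_sq ℝ
  have hL_cont : Continuous fun t => ∫ x, ‖Torus.laplacian (u t) x‖ ^ 2 :=
    continuousOn_univ.1 (hL_st.continuousOn_integral convex_univ)
  have hg_cont : Continuous fun t => Torus.gradNormSq (u t) :=
    continuousOn_univ.1 (hu.continuousOn_gradNormSq convex_univ uniqueDiffOn_univ)
  set G : ℝ := τ⁻¹ * ∫ t in (0 : ℝ)..τ, Torus.gradNormSq (u t) with hGdef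
  set L : ℝ := τ⁻¹ * ∫ t in (0 : ℝ)..τ, ∫ x, ‖Torus.laplacian (u t) x‖ ^ 2 with hLdef
  have hτinv : 0 < τ⁻¹ := inv_pos.2 hτ
  have hG : 0 ≤ G := mul_nonneg hτinv.le (intervalIntegral.integral_nonneg hτ.le fun t _ => Torus.gradNormSq_nonneg _)
  have hL : 0 ≤ L := mul_nonneg hτinv.le
    (intervalIntegral.integral_nonneg hτ.le fun t _ => integral_nonneg fun _ => sq_nonneg _)
  have hE : 0 ≤ meanEnergy u := meanEnergy_nonneg' hper hτ
  have hEeq : meanEnergy u = τ⁻¹ * ∫ t in (0 : ℝ)..τ, ∫ x, ‖u t x‖ ^ 2 := meanEnergy_eq_period_mean hper hτ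
  refine sq_le_mul_of_forall_weighted hE hL hG fun lam hl => ?_
  have hpt : ∀ t, 2 * Torus.gradNormSq (u t) ≤
      lam * (∫ x, ‖u t x‖ ^ 2) + (∫ x, ‖Torus.laplacian (u t) x‖ ^ 2) / lam := fun t =>
    two_mul_gradNormSq_le_weighted (hu.isSmooth_slice (mem_univ t)) hl
  have hi1 : IntervalIntegrable (fun t => Torus.gradNormSq (u t)) volume 0 τ := hg_cont.intervalIntegrable _ _
  have hi2 : IntervalIntegrable (fun t => lam * (∫ x, ‖u t x‖ ^ 2) + (∫ x, ‖Torus.laplacian (u t) x‖ ^ 2) / lam)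
      volume 0 τ := ((he_cont.const_mul lam).add (hL_cont.div_const lam)).intervalIntegrable _ _
  have htime : 2 * ∫ t in (0 : ℝ)..τ, Torus.gradNormSq (u t) ≤
      lam * (∫ t in (0 : ℝ)..τ, ∫ x, ‖u t x‖ ^ 2) + (∫ t in (0 : ℝ)..τ, ∫ x, ‖Torus.laplacian (u t) x‖ ^ 2) / lam := by
    calc 2 * ∫ t in (0 : ℝ)..τ, Torus.gradNormSq (u t)
        = ∫ t in (0 : ℝ)..τ, 2 * Torus.gradNormSq (u t) := (intervalIntegral.integral_const_mul _ _).symm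
      _ ≤ ∫ t in (0 : ℝ)..τ, (lam * (∫ x, ‖u t x‖ ^ 2) + (∫ x, ‖Torus.laplacian (u t) x‖ ^ 2) / lam) :=
          intervalIntegral.integral_mono_on hτ.le (hi1.const_mul 2) hi2 fun t _ => hpt t
      _ = lam * (∫ t in (0 : ℝ)..τ, ∫ x, ‖u t x‖ ^ 2) +
            (∫ t in (0 : ℝ)..τ, ∫ x, ‖Torus.laplacian (u t) x‖ ^ 2) / lam := by
          rw [intervalIntegral.integral_add ((he_cont.const_mul lam).intervalIntegrable _ _)
              ((hL_cont.div_const lam).intervalIntegrable _ _),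
            intervalIntegral.integral_const_mul, intervalIntegral.integral_div]
  rw [hEeq]
  have := mul_le_mul_of_nonneg_left htime hτinv.le
  calc 2 * G = τ⁻¹ * (2 * ∫ t in (0 : ℝ)..τ, Torus.gradNormSq (u t)) := by rw [hGdef]; ring
    _ ≤ τ⁻¹ * (lam * (∫ t in (0 : ℝ)..τ, ∫ x, ‖u t x‖ ^ 2) +
          (∫ t in (0 : ℝ)..τ, ∫ x, ‖Torus.laplacian (u t) x‖ ^ 2) / lam) := this
    _ = lam * (τ⁻¹ * ∫ t in (0 : ℝ)..τ, ∫ x, ‖u t x‖ ^ 2) + L / lam := by rw [hLdef]; ring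

/-- PALINSTROPHY FLOOR: a loud witness (`ε > 0`, energy `≤ E`, dissipation `≥ ε` at viscosity `ν`) has
`τ⁻¹∫₀^τ ‖Δu‖₂² ≥ ε²/(ν²E)`. -/
theorem mean_laplacianNormSq_ge (hsol : Torus.IsClassicalNSSolutionOn univ ν (fun _ => force S c) u p)
    (hν : 0 < ν) (hper : Function.Periodic u τ) (hτ : 0 < τ) (hε : 0 < ε)
    (hEu : meanEnergy u ≤ E) (hεu : ε ≤ meanDissipation ν u) :
    ε ^ 2 / (ν ^ 2 * E) ≤ τ⁻¹ * ∫ t in (0 : ℝ)..τ, ∫ x, ‖Torus.laplacian (u t) x‖ ^ 2 := by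
  have hu := hsol.smooth_velocity
  have hfloor := mean_gradNormSq_ge hsol hν hper hτ hεu
  have hinterp := mean_gradNormSq_sq_le hu hper hτ
  set G : ℝ := τ⁻¹ * ∫ t in (0 : ℝ)..τ, Torus.gradNormSq (u t) with hGdef
  set L : ℝ := τ⁻¹ * ∫ t in (0 : ℝ)..τ, ∫ x, ‖Torus.laplacian (u t) x‖ ^ 2 with hLdef
  have hmE := meanEnergy_nonneg' hper hτ
  have hGpos : 0 < G := lt_of_lt_of_le (div_pos hε hν) hfloor
  -- `(ε/ν)² ≤ G² ≤ meanEnergy·L ≤ E·L`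
  have h1 : (ε / ν) ^ 2 ≤ meanEnergy u * L :=
    (pow_le_pow_left₀ (div_pos hε hν).le hfloor 2).trans hinterp
  have hmEpos : 0 < meanEnergy u := by
    by_contra h0
    have : meanEnergy u = 0 := le_antisymm (not_lt.1 h0) hmE
    rw [this, zero_mul] at h1
    have : 0 < (ε / ν) ^ 2 := by positivity
    linarith
  have hEpos : 0 < E := hmEpos.trans_le hEu
  have hL : 0 ≤ L := mul_nonneg (inv_nonneg.2 hτ.le)
    (intervalIntegral.integral_nonneg hτ.le fun t _ => integral_nonneg fun _ => sq_nonneg _)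
  have h2 : (ε / ν) ^ 2 ≤ E * L := h1.trans (mul_le_mul_of_nonneg_right hEu hL)
  rw [div_le_iff₀ (by positivity)]
  rw [div_pow, div_le_iff₀ (by positivity)] at h2
  linarith

/-- VISCOUS-FORCE FLOOR: the viscous force of a loud witness has mean-square `L²` norm
`τ⁻¹∫₀^τ ∫‖νΔu‖² ≥ ε²/E`, uniformly in the level. -/
theorem mean_viscousForce_sq_ge (hsol : Torus.IsClassicalNSSolutionOn univ ν (fun _ => force S c) u p)
    (hν : 0 < ν) (hper : Function.Periodic u τ) (hτ : 0 < τ) (hε : 0 < ε)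
    (hEu : meanEnergy u ≤ E) (hεu : ε ≤ meanDissipation ν u) :
    ε ^ 2 / E ≤ τ⁻¹ * ∫ t in (0 : ℝ)..τ, ∫ x, ‖ν • Torus.laplacian (u t) x‖ ^ 2 := by
  have h := mean_laplacianNormSq_ge hsol hν hper hτ hε hEu hεu
  have hE : 0 < E := by
    have hmE := meanEnergy_nonneg' hper hτ
    by_contra h0
    push Not at h0
    have hE0 : E = 0 := le_antisymm h0 (hmE.trans hEu)
    rw [hE0, mul_zero, div_zero] at h
    -- then `h : _ ≤ L` is vacuous; use the enstrophy/energy argument instead: energy 0 forces dissipation 0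
    have hpow := meanDissipation_sq_le hsol (isSmooth_force S c) hν.le hper hτ
    have hm0 : meanEnergy u = 0 := le_antisymm (hE0 ▸ hEu) hmE
    rw [hm0, mul_zero] at hpow
    nlinarith
  have hfun : (fun t => ∫ x, ‖ν • Torus.laplacian (u t) x‖ ^ 2) =
      fun t => ν ^ 2 * ∫ x, ‖Torus.laplacian (u t) x‖ ^ 2 := by
    funext t
    rw [← integral_const_mul]
    refine integral_congr_ae (ae_of_all _ fun x => ?_)
    show ‖ν • Torus.laplacian (u t) x‖ ^ 2 = ν ^ 2 * ‖Torus.laplacian (u t) x‖ ^ 2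
    rw [norm_smul, mul_pow, Real.norm_eq_abs, sq_abs]
  rw [hfun, intervalIntegral.integral_const_mul, ← mul_assoc, mul_comm τ⁻¹, mul_assoc]
  rw [div_le_iff₀ (by positivity)] at h
  rw [div_le_iff₀ hE]
  nlinarith [h]

/-- PALINSTROPHY FLOOR ON THE LOUD SET: every `c ∈ LOUD_j(S,E,ε)` (`ε > 0`) has a witness whose viscous force has
mean-square `L²` norm `≥ ε²/E` and whose palinstrophy exceeds `ε²(j+1)²/E`. -/
theorem exists_palinstrophy_ge_of_mem_loudSet (hε : 0 < ε) {j : ℕ} (hc : c ∈ loudSet S E ε j) :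
    ∃ (ν τ : ℝ) (u : ℝ → (UnitAddTorus (Fin 3)) → (EuclideanSpace ℝ (Fin 3))) (p : ℝ → (UnitAddTorus (Fin 3)) → ℝ), 0 < ν ∧ ν < 1 / ((j : ℝ) + 1) ∧ 0 < τ ∧
      Torus.IsClassicalNSSolutionOn univ ν (fun _ => force S c) u p ∧ Function.Periodic u τ ∧
      ε ^ 2 / E ≤ τ⁻¹ * ∫ t in (0 : ℝ)..τ, ∫ x, ‖ν • Torus.laplacian (u t) x‖ ^ 2 ∧
      ε ^ 2 * ((j : ℝ) + 1) ^ 2 / E ≤ τ⁻¹ * ∫ t in (0 : ℝ)..τ, ∫ x, ‖Torus.laplacian (u t) x‖ ^ 2 := by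
  obtain ⟨ν, hν, hνj, τ, u, p, hτ, hsol, hper, hEu, hεu⟩ := hc
  refine ⟨ν, τ, u, p, hν, hνj, hτ, hsol, hper, mean_viscousForce_sq_ge hsol hν hper hτ hε hEu hεu, ?_⟩
  have h := mean_laplacianNormSq_ge hsol hν hper hτ hε hEu hεu
  refine le_trans ?_ h
  have hmE := meanEnergy_nonneg' hper hτ
  have hE : 0 ≤ E := hmE.trans hEu
  rcases hE.eq_or_lt with hE0 | hEpos
  · rw [← hE0]; simp
  have hj : (0 : ℝ) < (j : ℝ) + 1 := by positivity
  have hνj' : ν * ((j : ℝ) + 1) < 1 := by rwa [lt_div_iff₀ hj] at hνj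
  rw [div_le_div_iff₀ hEpos (by positivity)]
  have hν2 : ν ^ 2 * ((j : ℝ) + 1) ^ 2 ≤ 1 := by
    have : ν * ((j : ℝ) + 1) ≤ 1 := hνj'.le
    have h0 : 0 ≤ ν * ((j : ℝ) + 1) := by positivity
    nlinarith
  have hε2 : 0 ≤ ε ^ 2 * E := by positivity
  calc ε ^ 2 * ((j : ℝ) + 1) ^ 2 * (ν ^ 2 * E) = (ν ^ 2 * ((j : ℝ) + 1) ^ 2) * (ε ^ 2 * E) := by ring
    _ ≤ 1 * (ε ^ 2 * E) := by gcongr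
    _ = ε ^ 2 * E := one_mul _

end Palinstrophy

end Summit.AnomalousDissipation.AnomalousDissipation.Theorems.DenseLoudDesignerForces.Negative

end
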